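import Literature.NumberTheory.Sieve.DrappeauDispersionR1ppMatch
import HarnessLib

/-!
# Drappeau 2017, §5.5: termwise identification of `ℛ₁''` with the sums of Theorem 2.1

Topic `Literature/NumberTheory/Sieve`, part of the formalisation of §5 of S. Drappeau, Proc. London
Math. Soc. (3) 114 (2017) 684–732 = arXiv:1504.05549, p. 20–21.  With the dictionary of
`DrappeauDispersionR1ppMatch`, each term of a blocked, re-indexed piece sum of `ℛ₁''` equals the
corresponding term of the (collapsed) left-hand side of Theorem 2.1 with coefficients
`b = bGen …` — for the positive sign block directly, for the negative one after complex
conjugation (the coefficients then being the conjugates).  Everything proved; the only definition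
is the general coefficient `bGen` (of which `bCoef` is the instance used for the positive block).

* `Drappeau2017.bGen` — coefficients with a general value function `V(h,n₁,n₂)`;
  `bCoef_eq_bGen`, `conj_bCoef_eq_bGen`;
* `cruxSum_bGen_eq` — the collapsed left-hand side for `bGen` and a general factor `w`;
* `term_match_pos`, `term_match_neg` — the termwise identifications.

## References

* S. Drappeau, Proc. London Math. Soc. (3) 114 (2017) 684–732, arXiv:1504.05549, §5.5 p. 20–21.
  [cite: Drappeau2017, §5.5]
-/

noncomputable section

open Finset Real Complex
open scoped ArithmeticFunction.Moebius FourierTransform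

namespace Literature.NumberTheory.Sieve

namespace Drappeau2017

/-- General coefficients `b_{𝐧,𝐫,𝐬}` with value function `V(h, n₁, n₂)` (same support conditions as
`bCoef`). [cite: Drappeau2017, §5.5 p. 20] -/
def bGen (a₁ a₂ : ℤ) (B : Finset ℕ) (q₀ n₀ : ℕ) (H : ℕ) (σ : ℤ) (nlo nhi δ₁ δ₂ : ℕ)
    (V : ℤ → ℕ → ℕ → ℂ) (n r s : ℕ) : ℂ :=
  ∑ n₁ ∈ B, ∑ n₂ ∈ B, ∑ h ∈ (Finset.Icc (-(H : ℤ)) H).filter (fun h : ℤ => h ≠ 0),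
      if (δ₂ * n₁ = s ∧ a₂.natAbs * n₀ * δ₁ * n₂ = r ∧ nVar σ a₁ a₂ q₀ h n₁ n₂ = (n : ℤ) ∧
          (Nat.Coprime n₁ n₂ ∧ n₁ ≡ n₂ [MOD q₀] ∧ (n₀ * n₁).Coprime q₀ ∧ (n₀ * n₂).Coprime q₀ ∧
            ((nlo : ℕ) : ℤ) ≤ nVar σ a₁ a₂ q₀ h n₁ n₂ ∧ nVar σ a₁ a₂ q₀ h n₁ n₂ < ((nhi : ℕ) : ℤ))) then V h n₁ n₂ else 0

/-- `bCoef` is `bGen` with the value of (5.23). [folklore] -/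
theorem bCoef_eq_bGen (a₁ a₂ : ℤ) (B : Finset ℕ) (q₀ n₀ l₁ l₂ : ℕ) (β : ℕ → ℂ) (ξ : ℝ) (H : ℕ)
    (σ : ℤ) (nlo nhi δ₁ δ₂ n r s : ℕ) :
    bCoef a₁ a₂ B q₀ n₀ l₁ l₂ β ξ H σ nlo nhi δ₁ δ₂ n r s =
      bGen a₁ a₂ B q₀ n₀ H σ nlo nhi δ₁ δ₂ (fun h n₁ n₂ => (β (n₀ * n₁) * starRingEnd ℂ (β (n₀ * n₂)) *
              ((𝐞 (-(ξ * h)) : ℂ) *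
                (𝐞 (-((h : ℝ) * a₁ *
                    ((((((q₀ : ℤ) * l₁ * l₂ * n₁ : ℤ) : ZMod (a₂.natAbs * n₀))⁻¹).val : ℕ) : ℝ) /
                      ((a₂ : ℝ) * n₀))) : ℂ)))) n r s := by
  unfold bCoef bGen
  rfl

/-- The conjugate coefficients are `bGen` with the conjugate value. [folklore] -/
theorem conj_bCoef_eq_bGen (a₁ a₂ : ℤ) (B : Finset ℕ) (q₀ n₀ l₁ l₂ : ℕ) (β : ℕ → ℂ) (ξ : ℝ)
    (H : ℕ) (σ : ℤ) (nlo nhi δ₁ δ₂ n r s : ℕ) :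
    starRingEnd ℂ (bCoef a₁ a₂ B q₀ n₀ l₁ l₂ β ξ H σ nlo nhi δ₁ δ₂ n r s) =
      bGen a₁ a₂ B q₀ n₀ H σ nlo nhi δ₁ δ₂ (fun h n₁ n₂ => starRingEnd ℂ (β (n₀ * n₁) * starRingEnd ℂ (β (n₀ * n₂)) *
              ((𝐞 (-(ξ * h)) : ℂ) *
                (𝐞 (-((h : ℝ) * a₁ *
                    ((((((q₀ : ℤ) * l₁ * l₂ * n₁ : ℤ) : ZMod (a₂.natAbs * n₀))⁻¹).val : ℕ) : ℝ) /
                      ((a₂ : ℝ) * n₀))) : ℂ)))) n r s := by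
  unfold bCoef bGen
  rw [map_sum]
  refine Finset.sum_congr rfl fun n₁ _ => ?_
  rw [map_sum]
  refine Finset.sum_congr rfl fun n₂ _ => ?_
  rw [map_sum]
  refine Finset.sum_congr rfl fun h _ => ?_
  split_ifs
  · rfl
  · exact map_zero _

/-- **The collapsed left-hand side for `bGen` and a general factor `w(𝐜,𝐝,𝐧,𝐫,𝐬)`.**
[cite: Drappeau2017, §5.5 p. 20] -/
theorem cruxSum_bGen_eq (a₁ a₂ : ℤ) (B : Finset ℕ) (q₀ n₀ : ℕ) (H : ℕ) (σ : ℤ)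
    (nlo nhi δ₁ δ₂ : ℕ) (V : ℤ → ℕ → ℕ → ℂ) (Ic Id In Ir Is : Finset ℕ) (m c₀ d₀ : ℕ)
    (w : ℕ → ℕ → ℕ → ℕ → ℕ → ℂ) :
    ∑ c ∈ Ic, ∑ d ∈ Id, ∑ n ∈ In, ∑ r ∈ Ir, ∑ s ∈ Is,
        (if (c ≡ c₀ [MOD m] ∧ d ≡ d₀ [MOD m] ∧ Nat.Coprime (m * r * d) (s * c)) then
          bGen a₁ a₂ B q₀ n₀ H σ nlo nhi δ₁ δ₂ V n r s * w c d n r s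
        else 0) =
      ∑ c ∈ Ic, ∑ d ∈ Id, ∑ n₁ ∈ B, ∑ n₂ ∈ B,
        ∑ h ∈ (Finset.Icc (-(H : ℤ)) H).filter (fun h : ℤ => h ≠ 0),
          if (0 ≤ nVar σ a₁ a₂ q₀ h n₁ n₂ ∧ (nVar σ a₁ a₂ q₀ h n₁ n₂).toNat ∈ In ∧ (a₂.natAbs * n₀ * δ₁ * n₂) ∈ Ir ∧ (δ₂ * n₁) ∈ Is ∧
          (c ≡ c₀ [MOD m] ∧ d ≡ d₀ [MOD m] ∧ Nat.Coprime (m * (a₂.natAbs * n₀ * δ₁ * n₂) * d) ((δ₂ * n₁) * c)) ∧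
          (Nat.Coprime n₁ n₂ ∧ n₁ ≡ n₂ [MOD q₀] ∧ (n₀ * n₁).Coprime q₀ ∧ (n₀ * n₂).Coprime q₀ ∧
            ((nlo : ℕ) : ℤ) ≤ nVar σ a₁ a₂ q₀ h n₁ n₂ ∧ nVar σ a₁ a₂ q₀ h n₁ n₂ < ((nhi : ℕ) : ℤ))) then
            V h n₁ n₂ * w c d (nVar σ a₁ a₂ q₀ h n₁ n₂).toNat (a₂.natAbs * n₀ * δ₁ * n₂) (δ₂ * n₁)
          else 0 := by
  refine Finset.sum_congr rfl fun c _ => Finset.sum_congr rfl fun d _ => ?_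
  have step1 : ∀ n r s : ℕ,
      (if (c ≡ c₀ [MOD m] ∧ d ≡ d₀ [MOD m] ∧ Nat.Coprime (m * r * d) (s * c)) then
          bGen a₁ a₂ B q₀ n₀ H σ nlo nhi δ₁ δ₂ V n r s * w c d n r s
        else 0) =
        ∑ n₁ ∈ B, ∑ n₂ ∈ B, ∑ h ∈ (Finset.Icc (-(H : ℤ)) H).filter (fun h : ℤ => h ≠ 0),
          if ((c ≡ c₀ [MOD m] ∧ d ≡ d₀ [MOD m] ∧ Nat.Coprime (m * r * d) (s * c)) ∧
              (δ₂ * n₁ = s ∧ a₂.natAbs * n₀ * δ₁ * n₂ = r ∧ nVar σ a₁ a₂ q₀ h n₁ n₂ = (n : ℤ) ∧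
          (Nat.Coprime n₁ n₂ ∧ n₁ ≡ n₂ [MOD q₀] ∧ (n₀ * n₁).Coprime q₀ ∧ (n₀ * n₂).Coprime q₀ ∧
            ((nlo : ℕ) : ℤ) ≤ nVar σ a₁ a₂ q₀ h n₁ n₂ ∧ nVar σ a₁ a₂ q₀ h n₁ n₂ < ((nhi : ℕ) : ℤ)))) then
            V h n₁ n₂ * w c d n r s
          else 0 := by
    intro n r s
    unfold bGen
    exact ite_sum3_mul _ B _ _ _ _
  simp_rw [step1]
  simp only [Finset.sum_comm (s := Is) (t := B),
    Finset.sum_comm (s := Is) (t := (Finset.Icc (-(H : ℤ)) H).filter (fun h : ℤ => h ≠ 0)),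
    Finset.sum_comm (s := Ir) (t := B),
    Finset.sum_comm (s := Ir) (t := (Finset.Icc (-(H : ℤ)) H).filter (fun h : ℤ => h ≠ 0)),
    Finset.sum_comm (s := In) (t := B),
    Finset.sum_comm (s := In) (t := (Finset.Icc (-(H : ℤ)) H).filter (fun h : ℤ => h ≠ 0))]
  refine Finset.sum_congr rfl fun n₁ _ => Finset.sum_congr rfl fun n₂ _ =>
    Finset.sum_congr rfl fun h _ => ?_
  rw [sum3_collapse In Ir Is (nVar σ a₁ a₂ q₀ h n₁ n₂) (a₂.natAbs * n₀ * δ₁ * n₂) (δ₂ * n₁)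
    (fun n r s => (c ≡ c₀ [MOD m] ∧ d ≡ d₀ [MOD m] ∧ Nat.Coprime (m * r * d) (s * c)))
    (Nat.Coprime n₁ n₂ ∧ n₁ ≡ n₂ [MOD q₀] ∧ (n₀ * n₁).Coprime q₀ ∧ (n₀ * n₂).Coprime q₀ ∧
            ((nlo : ℕ) : ℤ) ≤ nVar σ a₁ a₂ q₀ h n₁ n₂ ∧ nVar σ a₁ a₂ q₀ h n₁ n₂ < ((nhi : ℕ) : ℤ))]

/-! ### Termwise identification -/

section Terms

variable {a₁ a₂ : ℤ} {q₀ n₀ δ₁ δ₂ c d c₀ d₀ n₁ n₂ nlo nhi l₁ l₂ : ℕ} {β : ℕ → ℂ} {ξ : ℝ}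
  {In Ir Is : Finset ℕ} {G : ℕ → ℕ → ℂ} {g : ℝ → ℝ → ℝ → ℝ → ℝ → ℂ}

/-- The conditions of `ℛ₁''` imply the conditions of Theorem 2.1 (for a term with
`β(n₀n₁) ≠ 0`). [cite: Drappeau2017, §5.5 p. 20] -/
theorem collCond_of_ourCond (σ : ℤ) (hq₀n₀ : Nat.Coprime q₀ n₀)
    (hδ₂m : Nat.Coprime δ₂ (a₂.natAbs * n₀)) (hcm : Nat.Coprime c (a₂.natAbs * n₀))
    (hcls : c ≡ c₀ [MOD a₂.natAbs * n₀] ∧ d ≡ d₀ [MOD a₂.natAbs * n₀])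
    (hn₁a : Nat.Coprime (n₀ * n₁) a₂.natAbs) (hn₀n₁ : Nat.Coprime n₀ n₁) (h : ℤ)
    (hIn : ∀ z : ℤ, ((nlo : ℕ) : ℤ) ≤ z → z < ((nhi : ℕ) : ℤ) → z.toNat ∈ In)
    (hIr : a₂.natAbs * n₀ * δ₁ * n₂ ∈ Ir) (hIs : δ₂ * n₁ ∈ Is)
    (hour : ((Nat.Coprime (δ₁ * d) (δ₂ * c) ∧ Nat.Coprime n₁ n₂ ∧ ((n₀ * n₁).Coprime (q₀ * (δ₁ * d)) ∧ (n₀ * n₂).Coprime (q₀ * (δ₂ * c)) ∧ n₁ ≡ n₂ [MOD q₀])) ∧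
          (((nlo : ℕ) : ℤ) ≤ nVar σ a₁ a₂ q₀ h n₁ n₂ ∧ nVar σ a₁ a₂ q₀ h n₁ n₂ < ((nhi : ℕ) : ℤ)))) :
    (0 ≤ nVar σ a₁ a₂ q₀ h n₁ n₂ ∧ (nVar σ a₁ a₂ q₀ h n₁ n₂).toNat ∈ In ∧ (a₂.natAbs * n₀ * δ₁ * n₂) ∈ Ir ∧ (δ₂ * n₁) ∈ Is ∧
          (c ≡ c₀ [MOD a₂.natAbs * n₀] ∧ d ≡ d₀ [MOD a₂.natAbs * n₀] ∧ Nat.Coprime (a₂.natAbs * n₀ * (a₂.natAbs * n₀ * δ₁ * n₂) * d) ((δ₂ * n₁) * c)) ∧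
          (Nat.Coprime n₁ n₂ ∧ n₁ ≡ n₂ [MOD q₀] ∧ (n₀ * n₁).Coprime q₀ ∧ (n₀ * n₂).Coprime q₀ ∧
            ((nlo : ℕ) : ℤ) ≤ nVar σ a₁ a₂ q₀ h n₁ n₂ ∧ nVar σ a₁ a₂ q₀ h n₁ n₂ < ((nhi : ℕ) : ℤ))) := by
  obtain ⟨⟨C1, C2, C3, C4, C5⟩, hb1, hb2⟩ := hour
  have _ := hq₀n₀
  refine ⟨le_trans (by positivity) hb1, hIn _ hb1 hb2, hIr, hIs, ⟨hcls.1, hcls.2, ?_⟩,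
    ⟨C2, C5, C3.coprime_mul_right_right, C4.coprime_mul_right_right, hb1, hb2⟩⟩
  exact crux_coprime_of_conds (hδ₂m.coprime_mul_right_right).symm (hn₁a.coprime_mul_left).symm
    (hcm.coprime_mul_right_right).symm (hδ₂m.coprime_mul_left_right).symm hn₀n₁
    (hcm.coprime_mul_left_right).symm C1 C2 (C3.coprime_mul_left).coprime_mul_left_right
    (C4.coprime_mul_left).coprime_mul_left_right

/-- The conditions of Theorem 2.1 imply the conditions of `ℛ₁''`. [cite: Drappeau2017, §5.5 p. 20] -/
theorem ourCond_of_collCond (σ : ℤ) (hq₀n₀ : Nat.Coprime q₀ n₀)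
    (hδ₁m : Nat.Coprime δ₁ (a₂.natAbs * n₀)) (hdm : Nat.Coprime d (a₂.natAbs * n₀)) (h : ℤ)
    (hcoll : (0 ≤ nVar σ a₁ a₂ q₀ h n₁ n₂ ∧ (nVar σ a₁ a₂ q₀ h n₁ n₂).toNat ∈ In ∧ (a₂.natAbs * n₀ * δ₁ * n₂) ∈ Ir ∧ (δ₂ * n₁) ∈ Is ∧
          (c ≡ c₀ [MOD a₂.natAbs * n₀] ∧ d ≡ d₀ [MOD a₂.natAbs * n₀] ∧ Nat.Coprime (a₂.natAbs * n₀ * (a₂.natAbs * n₀ * δ₁ * n₂) * d) ((δ₂ * n₁) * c)) ∧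
          (Nat.Coprime n₁ n₂ ∧ n₁ ≡ n₂ [MOD q₀] ∧ (n₀ * n₁).Coprime q₀ ∧ (n₀ * n₂).Coprime q₀ ∧
            ((nlo : ℕ) : ℤ) ≤ nVar σ a₁ a₂ q₀ h n₁ n₂ ∧ nVar σ a₁ a₂ q₀ h n₁ n₂ < ((nhi : ℕ) : ℤ)))) :
    ((Nat.Coprime (δ₁ * d) (δ₂ * c) ∧ Nat.Coprime n₁ n₂ ∧ ((n₀ * n₁).Coprime (q₀ * (δ₁ * d)) ∧ (n₀ * n₂).Coprime (q₀ * (δ₂ * c)) ∧ n₁ ≡ n₂ [MOD q₀])) ∧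
          (((nlo : ℕ) : ℤ) ≤ nVar σ a₁ a₂ q₀ h n₁ n₂ ∧ nVar σ a₁ a₂ q₀ h n₁ n₂ < ((nhi : ℕ) : ℤ))) := by
  obtain ⟨_, _, _, _, ⟨_, _, hcop⟩, C2, C5, hn₁q₀, hn₂q₀, hb1, hb2⟩ := hcoll
  obtain ⟨C1, C3, C4⟩ := conds_of_crux_coprime hcop hq₀n₀ (hδ₁m.coprime_mul_left_right).symm
    (hdm.coprime_mul_left_right).symm hn₁q₀ hn₂q₀
  exact ⟨⟨C1, C2, C3, C4, C5⟩, hb1, hb2⟩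

/-- **Termwise identification, positive block.**  For `𝐜 = c`, `𝐝 = d` in the prescribed
classes (coprime to `m = |a₂|n₀`), `(δ_j, m) = 1`, `(q₀, n₀) = 1`, `n₁ n₀` coprime to `a₂`, `β`
supported on squarefrees, and a weight with `G(δ₁d, δ₂c) = g(c,d,𝐧,𝐫,𝐬)`:
the term of the blocked re-indexed piece sum (`σ = 1`) equals the term of the collapsed left-hand
side of Theorem 2.1 with coefficients `bCoef`. [cite: Drappeau2017, §5.5 p. 20–21] -/
theorem term_match_pos (ha₂ : a₂ ≠ 0) (hq₀n₀ : Nat.Coprime q₀ n₀)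
    (hδ₁m : Nat.Coprime δ₁ (a₂.natAbs * n₀)) (hδ₂m : Nat.Coprime δ₂ (a₂.natAbs * n₀))
    (hc : 0 < c) (hcm : Nat.Coprime c (a₂.natAbs * n₀)) (hdm : Nat.Coprime d (a₂.natAbs * n₀))
    (hcls : c ≡ c₀ [MOD a₂.natAbs * n₀] ∧ d ≡ d₀ [MOD a₂.natAbs * n₀])
    (hn₁ : 0 < n₁) (hn₁a : Nat.Coprime (n₀ * n₁) a₂.natAbs)
    (hβ : ∀ n, ¬Squarefree n → β n = 0) (h : ℤ) (hδ₂ : 0 < δ₂)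
    (hIn : ∀ z : ℤ, ((nlo : ℕ) : ℤ) ≤ z → z < ((nhi : ℕ) : ℤ) → z.toNat ∈ In)
    (hIr : a₂.natAbs * n₀ * δ₁ * n₂ ∈ Ir) (hIs : δ₂ * n₁ ∈ Is)
    (hGg : ((nlo : ℕ) : ℤ) ≤ nVar 1 a₁ a₂ q₀ h n₁ n₂ → nVar 1 a₁ a₂ q₀ h n₁ n₂ < ((nhi : ℕ) : ℤ) →
      G (δ₁ * d) (δ₂ * c) = g c d (nVar 1 a₁ a₂ q₀ h n₁ n₂).toNat ((a₂.natAbs * n₀ * δ₁ * n₂ : ℕ) : ℝ) ((δ₂ * n₁ : ℕ) : ℝ)) :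
    (if ((Nat.Coprime (δ₁ * d) (δ₂ * c) ∧ Nat.Coprime n₁ n₂ ∧ ((n₀ * n₁).Coprime (q₀ * (δ₁ * d)) ∧ (n₀ * n₂).Coprime (q₀ * (δ₂ * c)) ∧ n₁ ≡ n₂ [MOD q₀])) ∧
          (((nlo : ℕ) : ℤ) ≤ nVar 1 a₁ a₂ q₀ h n₁ n₂ ∧ nVar 1 a₁ a₂ q₀ h n₁ n₂ < ((nhi : ℕ) : ℤ))) then
            G (δ₁ * d) (δ₂ * c) * (β (n₀ * n₁) * starRingEnd ℂ (β (n₀ * n₂))) *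
              ((𝐞 (-(ξ * h)) : ℂ) *
                ((𝐞 ((h : ℝ) * a₁ * ((((n₁ : ℤ) - n₂) / q₀ : ℤ)) *
                    (((((((δ₁ * d : ℕ) : ℤ) * a₂ * n₀ * n₂ : ℤ) : ZMod (n₁ * (δ₂ * c)))⁻¹).val : ℕ) : ℝ) /
                      ((n₁ : ℝ) * ((δ₂ * c : ℕ) : ℝ))) : ℂ) *
                  (𝐞 (-((h : ℝ) * a₁ *
                    ((((((q₀ : ℤ) * l₁ * l₂ * n₁ : ℤ) : ZMod (a₂.natAbs * n₀))⁻¹).val : ℕ) : ℝ) /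
                      ((a₂ : ℝ) * n₀))) : ℂ)))
      else 0) =
      (if (0 ≤ nVar 1 a₁ a₂ q₀ h n₁ n₂ ∧ (nVar 1 a₁ a₂ q₀ h n₁ n₂).toNat ∈ In ∧ (a₂.natAbs * n₀ * δ₁ * n₂) ∈ Ir ∧ (δ₂ * n₁) ∈ Is ∧
          (c ≡ c₀ [MOD a₂.natAbs * n₀] ∧ d ≡ d₀ [MOD a₂.natAbs * n₀] ∧ Nat.Coprime (a₂.natAbs * n₀ * (a₂.natAbs * n₀ * δ₁ * n₂) * d) ((δ₂ * n₁) * c)) ∧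
          (Nat.Coprime n₁ n₂ ∧ n₁ ≡ n₂ [MOD q₀] ∧ (n₀ * n₁).Coprime q₀ ∧ (n₀ * n₂).Coprime q₀ ∧
            ((nlo : ℕ) : ℤ) ≤ nVar 1 a₁ a₂ q₀ h n₁ n₂ ∧ nVar 1 a₁ a₂ q₀ h n₁ n₂ < ((nhi : ℕ) : ℤ))) then
            (β (n₀ * n₁) * starRingEnd ℂ (β (n₀ * n₂)) *
              ((𝐞 (-(ξ * h)) : ℂ) *
                (𝐞 (-((h : ℝ) * a₁ *
                    ((((((q₀ : ℤ) * l₁ * l₂ * n₁ : ℤ) : ZMod (a₂.natAbs * n₀))⁻¹).val : ℕ) : ℝ) /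
                      ((a₂ : ℝ) * n₀))) : ℂ))) *
            (g c d (nVar 1 a₁ a₂ q₀ h n₁ n₂).toNat ((a₂.natAbs * n₀ * δ₁ * n₂ : ℕ) : ℝ) ((δ₂ * n₁ : ℕ) : ℝ) *
              (𝐞 (((nVar 1 a₁ a₂ q₀ h n₁ n₂).toNat : ℝ) * (((((a₂.natAbs * n₀ * δ₁ * n₂) * d : ℕ) : ZMod ((δ₂ * n₁) * c))⁻¹).val : ℝ) /
                (((δ₂ * n₁ : ℕ) : ℝ) * c)) : ℂ))
          else 0) := by
  by_cases hour : ((Nat.Coprime (δ₁ * d) (δ₂ * c) ∧ Nat.Coprime n₁ n₂ ∧ ((n₀ * n₁).Coprime (q₀ * (δ₁ * d)) ∧ (n₀ * n₂).Coprime (q₀ * (δ₂ * c)) ∧ n₁ ≡ n₂ [MOD q₀])) ∧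
          (((nlo : ℕ) : ℤ) ≤ nVar 1 a₁ a₂ q₀ h n₁ n₂ ∧ nVar 1 a₁ a₂ q₀ h n₁ n₂ < ((nhi : ℕ) : ℤ)))
  swap
  · rw [if_neg hour]
    split_ifs with hcoll
    · exact absurd (ourCond_of_collCond 1 hq₀n₀ hδ₁m hdm h hcoll) hour
    · rfl
  rw [if_pos hour]
  by_cases hβ0 : β (n₀ * n₁) = 0
  · rw [hβ0]; split_ifs <;> simp
  have hsf : Squarefree (n₀ * n₁) := by by_contra h'; exact hβ0 (hβ _ h')
  have hn₀n₁ : Nat.Coprime n₀ n₁ := Nat.coprime_of_squarefree_mul hsf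
  have hcoll : (0 ≤ nVar 1 a₁ a₂ q₀ h n₁ n₂ ∧ (nVar 1 a₁ a₂ q₀ h n₁ n₂).toNat ∈ In ∧ (a₂.natAbs * n₀ * δ₁ * n₂) ∈ Ir ∧ (δ₂ * n₁) ∈ Is ∧
          (c ≡ c₀ [MOD a₂.natAbs * n₀] ∧ d ≡ d₀ [MOD a₂.natAbs * n₀] ∧ Nat.Coprime (a₂.natAbs * n₀ * (a₂.natAbs * n₀ * δ₁ * n₂) * d) ((δ₂ * n₁) * c)) ∧
          (Nat.Coprime n₁ n₂ ∧ n₁ ≡ n₂ [MOD q₀] ∧ (n₀ * n₁).Coprime q₀ ∧ (n₀ * n₂).Coprime q₀ ∧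
            ((nlo : ℕ) : ℤ) ≤ nVar 1 a₁ a₂ q₀ h n₁ n₂ ∧ nVar 1 a₁ a₂ q₀ h n₁ n₂ < ((nhi : ℕ) : ℤ))) :=
    collCond_of_ourCond 1 hq₀n₀ hδ₂m hcm hcls hn₁a hn₀n₁ h hIn hIr hIs hour
  rw [if_pos hcoll, hGg hour.2.1 hour.2.2]
  -- the phase
  have hcop := hcoll.2.2.2.2.1.2.2
  have hunit : Nat.Coprime (a₂.natAbs * n₀ * δ₁ * n₂ * d) (δ₂ * n₁ * c) :=
    Nat.Coprime.coprime_dvd_left ⟨a₂.natAbs * n₀, by ring⟩ hcop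
  have hW : 0 < δ₂ * n₁ * c := by positivity
  rw [phase_match ha₂ h hW hunit]
  have h0 : 0 ≤ nVar 1 a₁ a₂ q₀ h n₁ n₂ := hcoll.1
  have hN : (((nVar 1 a₁ a₂ q₀ h n₁ n₂).toNat : ℕ) : ℝ) =
      ((a₂.sign * a₁ * h * (((n₁ : ℤ) - n₂) / q₀) : ℤ) : ℝ) := by
    rw [show (((nVar 1 a₁ a₂ q₀ h n₁ n₂).toNat : ℕ) : ℝ) =
        (((nVar 1 a₁ a₂ q₀ h n₁ n₂).toNat : ℤ) : ℝ) by norm_cast, Int.toNat_of_nonneg h0]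
    unfold nVar; push_cast; ring
  rw [hN]
  ring

/-- **Termwise identification, negative block** (after conjugation; the weight is real:
`conj G = G`). [cite: Drappeau2017, §5.5 p. 20–21] -/
theorem term_match_neg (ha₂ : a₂ ≠ 0) (hq₀n₀ : Nat.Coprime q₀ n₀)
    (hδ₁m : Nat.Coprime δ₁ (a₂.natAbs * n₀)) (hδ₂m : Nat.Coprime δ₂ (a₂.natAbs * n₀))
    (hc : 0 < c) (hcm : Nat.Coprime c (a₂.natAbs * n₀)) (hdm : Nat.Coprime d (a₂.natAbs * n₀))
    (hcls : c ≡ c₀ [MOD a₂.natAbs * n₀] ∧ d ≡ d₀ [MOD a₂.natAbs * n₀])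
    (hn₁ : 0 < n₁) (hn₁a : Nat.Coprime (n₀ * n₁) a₂.natAbs)
    (hβ : ∀ n, ¬Squarefree n → β n = 0) (h : ℤ) (hδ₂ : 0 < δ₂)
    (hIn : ∀ z : ℤ, ((nlo : ℕ) : ℤ) ≤ z → z < ((nhi : ℕ) : ℤ) → z.toNat ∈ In)
    (hIr : a₂.natAbs * n₀ * δ₁ * n₂ ∈ Ir) (hIs : δ₂ * n₁ ∈ Is)
    (hGreal : starRingEnd ℂ (G (δ₁ * d) (δ₂ * c)) = G (δ₁ * d) (δ₂ * c))
    (hGg : ((nlo : ℕ) : ℤ) ≤ nVar (-1) a₁ a₂ q₀ h n₁ n₂ → nVar (-1) a₁ a₂ q₀ h n₁ n₂ < ((nhi : ℕ) : ℤ) →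
      G (δ₁ * d) (δ₂ * c) = g c d (nVar (-1) a₁ a₂ q₀ h n₁ n₂).toNat ((a₂.natAbs * n₀ * δ₁ * n₂ : ℕ) : ℝ) ((δ₂ * n₁ : ℕ) : ℝ)) :
    starRingEnd ℂ (if ((Nat.Coprime (δ₁ * d) (δ₂ * c) ∧ Nat.Coprime n₁ n₂ ∧ ((n₀ * n₁).Coprime (q₀ * (δ₁ * d)) ∧ (n₀ * n₂).Coprime (q₀ * (δ₂ * c)) ∧ n₁ ≡ n₂ [MOD q₀])) ∧
          (((nlo : ℕ) : ℤ) ≤ nVar (-1) a₁ a₂ q₀ h n₁ n₂ ∧ nVar (-1) a₁ a₂ q₀ h n₁ n₂ < ((nhi : ℕ) : ℤ))) then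
            G (δ₁ * d) (δ₂ * c) * (β (n₀ * n₁) * starRingEnd ℂ (β (n₀ * n₂))) *
              ((𝐞 (-(ξ * h)) : ℂ) *
                ((𝐞 ((h : ℝ) * a₁ * ((((n₁ : ℤ) - n₂) / q₀ : ℤ)) *
                    (((((((δ₁ * d : ℕ) : ℤ) * a₂ * n₀ * n₂ : ℤ) : ZMod (n₁ * (δ₂ * c)))⁻¹).val : ℕ) : ℝ) /
                      ((n₁ : ℝ) * ((δ₂ * c : ℕ) : ℝ))) : ℂ) *
                  (𝐞 (-((h : ℝ) * a₁ *
                    ((((((q₀ : ℤ) * l₁ * l₂ * n₁ : ℤ) : ZMod (a₂.natAbs * n₀))⁻¹).val : ℕ) : ℝ) /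
                      ((a₂ : ℝ) * n₀))) : ℂ)))
      else 0) =
      (if (0 ≤ nVar (-1) a₁ a₂ q₀ h n₁ n₂ ∧ (nVar (-1) a₁ a₂ q₀ h n₁ n₂).toNat ∈ In ∧ (a₂.natAbs * n₀ * δ₁ * n₂) ∈ Ir ∧ (δ₂ * n₁) ∈ Is ∧
          (c ≡ c₀ [MOD a₂.natAbs * n₀] ∧ d ≡ d₀ [MOD a₂.natAbs * n₀] ∧ Nat.Coprime (a₂.natAbs * n₀ * (a₂.natAbs * n₀ * δ₁ * n₂) * d) ((δ₂ * n₁) * c)) ∧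
          (Nat.Coprime n₁ n₂ ∧ n₁ ≡ n₂ [MOD q₀] ∧ (n₀ * n₁).Coprime q₀ ∧ (n₀ * n₂).Coprime q₀ ∧
            ((nlo : ℕ) : ℤ) ≤ nVar (-1) a₁ a₂ q₀ h n₁ n₂ ∧ nVar (-1) a₁ a₂ q₀ h n₁ n₂ < ((nhi : ℕ) : ℤ))) then
            starRingEnd ℂ (β (n₀ * n₁) * starRingEnd ℂ (β (n₀ * n₂)) *
              ((𝐞 (-(ξ * h)) : ℂ) *
                (𝐞 (-((h : ℝ) * a₁ *
                    ((((((q₀ : ℤ) * l₁ * l₂ * n₁ : ℤ) : ZMod (a₂.natAbs * n₀))⁻¹).val : ℕ) : ℝ) /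
                      ((a₂ : ℝ) * n₀))) : ℂ))) *
            (g c d (nVar (-1) a₁ a₂ q₀ h n₁ n₂).toNat ((a₂.natAbs * n₀ * δ₁ * n₂ : ℕ) : ℝ) ((δ₂ * n₁ : ℕ) : ℝ) *
              (𝐞 (((nVar (-1) a₁ a₂ q₀ h n₁ n₂).toNat : ℝ) * (((((a₂.natAbs * n₀ * δ₁ * n₂) * d : ℕ) : ZMod ((δ₂ * n₁) * c))⁻¹).val : ℝ) /
                (((δ₂ * n₁ : ℕ) : ℝ) * c)) : ℂ))
          else 0) := by
  by_cases hour : ((Nat.Coprime (δ₁ * d) (δ₂ * c) ∧ Nat.Coprime n₁ n₂ ∧ ((n₀ * n₁).Coprime (q₀ * (δ₁ * d)) ∧ (n₀ * n₂).Coprime (q₀ * (δ₂ * c)) ∧ n₁ ≡ n₂ [MOD q₀])) ∧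
          (((nlo : ℕ) : ℤ) ≤ nVar (-1) a₁ a₂ q₀ h n₁ n₂ ∧ nVar (-1) a₁ a₂ q₀ h n₁ n₂ < ((nhi : ℕ) : ℤ)))
  swap
  · rw [if_neg hour, map_zero]
    split_ifs with hcoll
    · exact absurd (ourCond_of_collCond (-1) hq₀n₀ hδ₁m hdm h hcoll) hour
    · rfl
  rw [if_pos hour]
  by_cases hβ0 : β (n₀ * n₁) = 0
  · rw [hβ0]; split_ifs <;> simp
  have hsf : Squarefree (n₀ * n₁) := by by_contra h'; exact hβ0 (hβ _ h')
  have hn₀n₁ : Nat.Coprime n₀ n₁ := Nat.coprime_of_squarefree_mul hsf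
  have hcoll : (0 ≤ nVar (-1) a₁ a₂ q₀ h n₁ n₂ ∧ (nVar (-1) a₁ a₂ q₀ h n₁ n₂).toNat ∈ In ∧ (a₂.natAbs * n₀ * δ₁ * n₂) ∈ Ir ∧ (δ₂ * n₁) ∈ Is ∧
          (c ≡ c₀ [MOD a₂.natAbs * n₀] ∧ d ≡ d₀ [MOD a₂.natAbs * n₀] ∧ Nat.Coprime (a₂.natAbs * n₀ * (a₂.natAbs * n₀ * δ₁ * n₂) * d) ((δ₂ * n₁) * c)) ∧
          (Nat.Coprime n₁ n₂ ∧ n₁ ≡ n₂ [MOD q₀] ∧ (n₀ * n₁).Coprime q₀ ∧ (n₀ * n₂).Coprime q₀ ∧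
            ((nlo : ℕ) : ℤ) ≤ nVar (-1) a₁ a₂ q₀ h n₁ n₂ ∧ nVar (-1) a₁ a₂ q₀ h n₁ n₂ < ((nhi : ℕ) : ℤ))) :=
    collCond_of_ourCond (-1) hq₀n₀ hδ₂m hcm hcls hn₁a hn₀n₁ h hIn hIr hIs hour
  rw [if_pos hcoll]
  have hcop := hcoll.2.2.2.2.1.2.2
  have hunit : Nat.Coprime (a₂.natAbs * n₀ * δ₁ * n₂ * d) (δ₂ * n₁ * c) :=
    Nat.Coprime.coprime_dvd_left ⟨a₂.natAbs * n₀, by ring⟩ hcop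
  have hW : 0 < δ₂ * n₁ * c := by positivity
  have h0 : 0 ≤ nVar (-1) a₁ a₂ q₀ h n₁ n₂ := hcoll.1
  have hN : (((nVar (-1) a₁ a₂ q₀ h n₁ n₂).toNat : ℕ) : ℝ) =
      -((a₂.sign * a₁ * h * (((n₁ : ℤ) - n₂) / q₀) : ℤ) : ℝ) := by
    rw [show (((nVar (-1) a₁ a₂ q₀ h n₁ n₂).toNat : ℕ) : ℝ) =
        (((nVar (-1) a₁ a₂ q₀ h n₁ n₂).toNat : ℤ) : ℝ) by norm_cast, Int.toNat_of_nonneg h0]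
    unfold nVar; push_cast; ring
  rw [phase_match ha₂ h hW hunit]
  simp only [map_mul, CircleMethodKernel.conj_fourierChar_coe, Complex.conj_conj, hGreal]
  rw [hGg hour.2.1 hour.2.2, hN]
  simp only [neg_mul, neg_div, neg_neg]
  ring

end Terms

end Drappeau2017

end Literature.NumberTheory.Sieve

end
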